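/-
STUB-IDEAS k1 (gen 12) — Lean sketch for the stub `stub_heegnerIndexLowerAtTwo`
(crux stmt-BirchSwinnertonDyer-27851 = `PrintCf2.SplitBadTwoLowerHalfOfFacts`, LOWER half of BSD₂
on the split-bad class `49a1^{(d)}, 49a2^{(d)}`, `4 ∣ d_K`).  TECHNIQUE «weaken / strengthen».

LEVER.  The WEAKEST sufficient global input for LOWER's T1 node is the two-variable main
conjecture only UP TO POWERS OF 2 (its `⊗ ℚ₂` shadow, shape `…UpToPow` below); the STRONGEST
provable form LOWER consumes — the INTEGRAL containment `char X ⊆ (G₂)` — is recovered from the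
shadow by prime cancellation (§A) because the analytic μ-invariant of the elliptic-unit measure
vanishes (Oukhaba–Viguié 2016, Thm 6.2 / Thm 1.2, ALL p): every unknown power of 2 coming from
χ-projection at `2 ∣ #Δ` (Johnson-Leung–Kings 2011 §5.4), from the choice of elliptic-unit lattice
(Robert vs 12-th powers) and from period normalisations is cancelled wholesale, never tabulated.

Nothing in this file proves BSD, the crux, or the stub: §A–§D, §G–§I are kernel-checked algebra;
§E–§F are helper SIGNATURES (sorried) for the stub prover; the research inputs enter as hypotheses.
-/
import Mathlib
import Literature.NumberTheory.EllipticCurves.IwasawaAlgebraCharIdealProofs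
import Literature.NumberTheory.EllipticCurves.Rubin1991.TwoVariableMainConjecture

set_option autoImplicit false
set_option linter.dupNamespace false

namespace Summit.BirchSwinnertonDyer.BirchSwinnertonDyer.Cruxes.SplitBadTwoLowerHalfOfFacts.StubIdeasK1G12

open Literature.NumberTheory.EllipticCurves

/-! ## §A  H1 — prime cancellation («μ = 0 on the divisor side kills every 2-power cofactor») -/

section H1

variable {R : Type*} [CommRing R] [IsDomain R]

/-- **H1.** If `p` is prime, `p ∤ G` and `G ∣ p^k · f`, then `G ∣ f`. -/
theorem dvd_of_dvd_prime_pow_mul {p G f : R} (hp : Prime p) (hG : ¬ p ∣ G) :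
    ∀ {k : ℕ}, G ∣ p ^ k * f → G ∣ f := by
  intro k
  induction k with
  | zero => intro h; simpa using h
  | succ k ih =>
    intro h
    obtain ⟨c, hc⟩ := h
    have hpc : p ∣ G * c := ⟨p ^ k * f, by rw [← hc]; ring⟩
    rcases hp.dvd_or_dvd hpc with hpG | ⟨c', rfl⟩
    · exact absurd hpG hG
    · apply ih
      refine ⟨c', mul_left_cancel₀ hp.ne_zero ?_⟩
      calc p * (p ^ k * f) = p ^ (k + 1) * f := by ring
        _ = G * (p * c') := hc
        _ = p * (G * c') := by ring

/-- **H1′ (ideal form).** `p^k · I ⊆ (G)` and `p ∤ G` ⟹ `I ⊆ (G)`. -/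
theorem le_span_singleton_of_span_pow_mul_le {p G : R} (hp : Prime p) (hG : ¬ p ∣ G) {k : ℕ}
    {I : Ideal R} (h : Ideal.span {p ^ k} * I ≤ Ideal.span {G}) : I ≤ Ideal.span {G} := by
  intro x hx
  have hx' : p ^ k * x ∈ Ideal.span {G} :=
    h (Ideal.mul_mem_mul (Ideal.mem_span_singleton_self _) hx)
  rw [Ideal.mem_span_singleton] at hx' ⊢
  exact dvd_of_dvd_prime_pow_mul hp hG hx'

/-- **H1″ (μ-sandwich ⟹ equality).** An identity up to powers of `p` between two `p`-free
elements is an identity up to a unit. -/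
theorem associated_of_pow_mul_eq {p f G : R} (hp : Prime p) (hf : ¬ p ∣ f) (hG : ¬ p ∣ G)
    {a b : ℕ} {u : Rˣ} (h : p ^ a * f = u * (p ^ b * G)) : Associated f G := by
  refine associated_of_dvd_dvd ?_ ?_
  · apply dvd_of_dvd_prime_pow_mul hp hf (k := b)
    refine ⟨↑u⁻¹ * p ^ a, ?_⟩
    calc p ^ b * G = (↑u⁻¹ * ↑u) * (p ^ b * G) := by simp
      _ = ↑u⁻¹ * (p ^ a * f) := by rw [mul_assoc, ← h]
      _ = f * (↑u⁻¹ * p ^ a) := by ring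
  · apply dvd_of_dvd_prime_pow_mul hp hG (k := a)
    exact ⟨↑u * p ^ b, by rw [h]; ring⟩

omit [IsDomain R] in
/-- **H1‴ (the normalisation digit is zero).** If `f = u · p^c · G` with `p ∤ f`, then `c = 0`:
a 2-power normalisation constant between two μ-free generators of the same ideal cannot occur. -/
theorem pow_index_eq_zero {p f G : R} (hf : ¬ p ∣ f) {c : ℕ} {u : Rˣ}
    (h : f = u * (p ^ c * G)) : c = 0 := by
  rcases c with _ | c
  · rfl
  · exact absurd ⟨↑u * p ^ c * G, by rw [h]; ring⟩ hf

/-- **H6 (μ = 0 transfers UP from any line).** If the image of `G` under some ring map `ρ`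
(restriction to ONE `ℤ₂`-line, e.g. Oukhaba–Viguié's `𝔭`-ramified line) is not divisible by
`ρ p`, then `p ∤ G` in two variables. -/
theorem not_dvd_of_map_not_dvd {A B : Type*} [CommRing A] [CommRing B] (ρ : A →+* B) {p G : A}
    (h : ¬ ρ p ∣ ρ G) : ¬ p ∣ G := fun hd => h (map_dvd ρ hd)

/-- **H7 (base change of a containment).** Containment over the native coefficient ring
(`ℤ₂`, `W(𝔽̄₂)`, `𝒪_θ` — where `2`/`ϖ` IS prime) implies containment after any scalar
extension, e.g. the LEAD's `J : ℤ_[2] →+* 𝒪_{ℂ₂}` (where `2` is NOT prime and H1 does not apply). -/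
theorem map_le_span_of_le_span {A B : Type*} [CommRing A] [CommRing B] (φ : A →+* B)
    {I : Ideal A} {g : A} (h : I ≤ Ideal.span {g}) : I.map φ ≤ Ideal.span {φ g} := by
  refine (Ideal.map_mono h).trans ?_
  rw [Ideal.map_span, Set.image_singleton]

end H1

/-! ## §B  `2` is a prime element of `Λ₂ = ℤ₂⟦T₁⟧⟦T₂⟧` (and of `𝒪⟦T₁⟧⟦T₂⟧` for any domain `𝒪`
with `2` prime) — the instance H1 is applied at. -/

section LambdaTwo

/-- `C (C π)` is prime in `A⟦T₂⟧⟦T₁⟧` whenever `π` is prime in `A` (tree lemma `prime_C_of_prime`,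
twice). -/
theorem prime_C_C_of_prime {A : Type*} [CommRing A] {π : A} (hπ : Prime π) :
    Prime (PowerSeries.C (PowerSeries.C π) : PowerSeries (PowerSeries A)) :=
  prime_C_of_prime (prime_C_of_prime hπ)

/-- `2 = C (C 2)` is a prime element of the two-variable Iwasawa algebra `IwasawaAlgebra₂ 2`. -/
theorem prime_two_iwasawaAlgebra₂ :
    Prime (PowerSeries.C (PowerSeries.C (2 : ℤ_[2])) : IwasawaAlgebra₂ 2) := by
  have h : Prime ((2 : ℕ) : ℤ_[2]) := PadicInt.prime_p
  exact prime_C_C_of_prime (by exact_mod_cast h)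

end LambdaTwo

/-! ## §C  The weakest sufficient shape: containment / equality UP TO POWERS OF `p`
(the `⊗ ℚ_p` shadow; cf. the tree idiom `Kato2004.CharIdealEqUpToConst`). -/

section UpToPow

variable {R : Type*} [CommRing R]

/-- `I ⊆ (G)` up to a power of `p`. -/
def LeSpanUpToPow (p G : R) (I : Ideal R) : Prop :=
  ∃ a : ℕ, Ideal.span {p ^ a} * I ≤ Ideal.span {G}

/-- `(f) = (G)` up to powers of `p` and a unit. -/
def EqUpToPow (p f G : R) : Prop :=
  ∃ (a b : ℕ) (u : Rˣ), p ^ a * f = u * (p ^ b * G)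

variable [IsDomain R]

/-- Upgrade of the shadow containment to the integral one, given analytic `μ = 0` (`p ∤ G`). -/
theorem le_span_of_leSpanUpToPow {p G : R} {I : Ideal R} (hp : Prime p) (hμ : ¬ p ∣ G)
    (h : LeSpanUpToPow p G I) : I ≤ Ideal.span {G} := by
  obtain ⟨a, ha⟩ := h
  exact le_span_singleton_of_span_pow_mul_le hp hμ ha

/-- Upgrade of the shadow equality to an integral equality of ideals, given `μ = 0` on BOTH sides
(algebraic: Müller 2020 Thm 3.21 / OV16 (41); analytic: OV16 Thm 6.2). -/
theorem span_eq_of_eqUpToPow {p f G : R} (hp : Prime p) (hf : ¬ p ∣ f) (hG : ¬ p ∣ G)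
    (h : EqUpToPow p f G) : Ideal.span {f} = Ideal.span {G} := by
  obtain ⟨a, b, u, h⟩ := h
  exact Ideal.span_singleton_eq_span_singleton.mpr (associated_of_pow_mul_eq hp hf hG h)

end UpToPow

/-! ## §D  The weakened final clause of S3a (`PrintCf2RubinValueTwo.TwoVariableMainConjAtSplitTwo`,
stmt-23720), abstracted over the objects of that clause: `X = D.X` over `Λ = IwasawaAlgebra₂ 2`,
the coefficient map `φ = PowerSeries.map (PowerSeries.map J)`, the measure `G₂`.
S3a (verbatim) ends in `(charIdeal Λ X).map φ = Ideal.span {G₂}`; LOWER needs only `≤`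
(S3a^⊆); this card's weakest sufficient form is S3a^ℚ⊆ = `≤` up to powers of 2, stated over the
NATIVE coefficients (H7 then moves it to `𝒪_{ℂ₂}`). -/

section S3aShapes

variable (Λ : Type*) [CommRing Λ] (X : Type*) [AddCommGroup X] [Module Λ X]
  {Λ' : Type*} [CommRing Λ']

/-- S3a^⊆: the containment LOWER consumes (after base change `φ`). -/
def CharLeSpan (φ : Λ →+* Λ') (G : Λ') : Prop :=
  (Module.charIdeal Λ X).map φ ≤ Ideal.span {G}

/-- S3a^ℚ⊆: the same up to powers of `p` — the `⊗ ℚ_p` reading of Johnson-Leung–Kings Thm 5.2 +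
§5.4 (χ-projectors exist over `𝒪_p[1/p]` for EVERY `#Δ`) + the rational Coleman/CFT dictionary. -/
def CharLeSpanUpToPow (φ : Λ →+* Λ') (p G : Λ') : Prop :=
  LeSpanUpToPow p G ((Module.charIdeal Λ X).map φ)

variable {Λ X}

/-- **The step proposed to the stub prover (T1 producer, two-variable habitat):**
S3a^ℚ⊆ over native coefficients + `p ∤ G₂` (OV16 Thm 6.2 via H6) ⟹ S3a^⊆. -/
theorem charLeSpan_of_upToPow_of_muZero [IsDomain Λ'] {φ : Λ →+* Λ'} {p G : Λ'} (hp : Prime p)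
    (hμ : ¬ p ∣ G) (h : CharLeSpanUpToPow Λ X φ p G) : CharLeSpan Λ X φ G :=
  le_span_of_leSpanUpToPow hp hμ h

/-- … and then to the LEAD's coefficient ring `𝒪_{ℂ₂}` by any further scalar extension `J'`. -/
theorem charLeSpan_map [IsDomain Λ'] {Λ'' : Type*} [CommRing Λ''] {φ : Λ →+* Λ'} {p G : Λ'}
    (J' : Λ' →+* Λ'') (hp : Prime p) (hμ : ¬ p ∣ G) (h : CharLeSpanUpToPow Λ X φ p G) :
    CharLeSpan Λ X (J'.comp φ) (J' G) := by
  have h1 := charLeSpan_of_upToPow_of_muZero hp hμ h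
  unfold CharLeSpan at h1 ⊢
  rw [← Ideal.map_map]
  exact map_le_span_of_le_span J' h1

end S3aShapes

/-! ## §E  H3 (helper SIGNATURE, Lean-M): χ-projection / lattice-change error terms are μ-TYPE.
A `Λ`-linear map whose kernel and cokernel are killed by `p^k` changes the characteristic ideal
only by powers of the height-one prime `(p)` (at every other height-one prime `p` is a unit in the
localisation). Used for: `Ĥ^i(Δ, ·)`-terms of the χ-projection at `2 ∣ #Δ` (killed by `#Δ`),
Robert-vs-12th-power elliptic-unit lattices (killed by 4), `±1 = μ(K₀)` torsion of local units. -/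

section MuType

/-- **H3 (signature).** Intended for `R = IwasawaAlgebra₂ 2` (Noetherian UFD, `(2)` the unique
height-one prime containing `2`). -/
theorem exists_span_pow_mul_charIdeal_eq_of_torsionBy_ker_coker
    {R : Type*} [CommRing R] [IsDomain R] [IsNoetherianRing R] [UniqueFactorizationMonoid R]
    {p : R} (hp : Prime p)
    {M N : Type*} [AddCommGroup M] [Module R M] [AddCommGroup N] [Module R N]
    [Module.Finite R M] [Module.Finite R N]
    (hM : Module.IsTorsion R M) (hN : Module.IsTorsion R N) (f : M →ₗ[R] N) (k : ℕ)
    (hker : ∀ x ∈ LinearMap.ker f, p ^ k • x = 0)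
    (hcoker : ∀ y : N, p ^ k • y ∈ LinearMap.range f) :
    ∃ a b : ℕ, Ideal.span {p ^ a} * Module.charIdeal R M = Ideal.span {p ^ b} * Module.charIdeal R N := by
  sorry

end MuType

/-! ## §F  H1♭ (helper SIGNATURE, Lean-S/M): the Gauss-norm variant of H1 over a rank-one valuation
ring such as `𝒪_{ℂ₂}` (where `2` is NOT prime, so H1 does not apply literally): if some coefficient
of `G` is a unit («Gauss norm 1 attained», the honest μ = 0 over `𝒪_{ℂ₂}`) and `G ∣ c · f` for a
constant `c ≠ 0`, then `G ∣ f` (multiplicativity of the Gauss norm on bounded series + `|h_n| ≤ |c|`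
⟹ `c ∣ h_n` in a valuation ring). Only needed if the LEAD insists on running T1 over `𝒪_{ℂ₂}`
instead of descending `G₂` to `W(𝔽̄₂)[θ]` first (recommended: H1 + H7). -/

section GaussNorm

/-- **H1♭ (signature).** -/
theorem dvd_of_dvd_C_C_mul_of_isUnit_coeff
    {𝒪 : Type*} [CommRing 𝒪] [IsDomain 𝒪] [ValuationRing 𝒪]
    {c : 𝒪} (hc : c ≠ 0) {G f : PowerSeries (PowerSeries 𝒪)}
    (hG : ∃ n m : ℕ, IsUnit (PowerSeries.coeff m (PowerSeries.coeff n G)))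
    (h : G ∣ PowerSeries.C (PowerSeries.C c) * f) : G ∣ f := by
  sorry

end GaussNorm

/-! ## §G  PLAN 1 assembly (line road, T1 producer): rational MC + μ = 0 on ONE line ⟹ integral
two-variable containment ⟹ containment on the LEAD's line ⟹ (with row 8's Ochiai/control input)
the hypothesis of the critic's certificate `LowerStubControlValue.lower_value_bound_of_dvd_control`. -/

section Plan1

/-- **PLAN 1, kernel-checked composition.** `hrat` = JLK 2011 Thm 5.2 ⊗ ℚ₂ + the rational
CFT/Coleman dictionary (R59-ℚ); `hμ` = OV16 Thm 6.2 on OV's `𝔭`-line `ρ` (R74); `π` = the LEAD's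
line; `hctrl` = row 8/11 (Ochiai specialisation + Agboola control, research-S). -/
theorem lineDvd_of_rationalMC_of_muZero
    {Λ₂ Λ₁ Λₒ : Type*} [CommRing Λ₂] [IsDomain Λ₂] [CommRing Λ₁] [CommRing Λₒ]
    {p G₂ f₂ : Λ₂} (hp : Prime p)
    (hrat : ∃ a : ℕ, G₂ ∣ p ^ a * f₂)
    (ρ : Λ₂ →+* Λₒ) (hμ : ¬ ρ p ∣ ρ G₂)
    (π : Λ₂ →+* Λ₁) {ctrl H : Λ₁} (hctrl : π f₂ ∣ ctrl * H) :
    π G₂ ∣ ctrl * H := by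
  obtain ⟨a, ha⟩ := hrat
  have hG : ¬ p ∣ G₂ := not_dvd_of_map_not_dvd ρ hμ
  exact (map_dvd π (dvd_of_dvd_prime_pow_mul hp hG ha)).trans hctrl

/-- The same in `IwasawaAlgebra₂ 2 → IwasawaAlgebra 2` clothes, value read at `T = 0`:
`G₂|_ℓ(0) ∣ ctrl(0) · H(0)` in `ℤ₂`, i.e. `ord₂ G|_ℓ(0) ≤ ord₂ ctrl(0) + n` — LOWER's inequality
direction (B1 ✓). -/
theorem constantCoeff_dvd_of_rationalMC_of_muZero
    {Λₒ : Type*} [CommRing Λₒ] {G₂ f₂ : IwasawaAlgebra₂ 2}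
    (hrat : ∃ a : ℕ, G₂ ∣ (PowerSeries.C (PowerSeries.C (2 : ℤ_[2]))) ^ a * f₂)
    (ρ : IwasawaAlgebra₂ 2 →+* Λₒ)
    (hμ : ¬ ρ (PowerSeries.C (PowerSeries.C (2 : ℤ_[2]))) ∣ ρ G₂)
    (π : IwasawaAlgebra₂ 2 →+* IwasawaAlgebra 2) {ctrl H : IwasawaAlgebra 2}
    (hctrl : π f₂ ∣ ctrl * H) :
    PowerSeries.constantCoeff (π G₂) ∣
      PowerSeries.constantCoeff ctrl * PowerSeries.constantCoeff H := by
  have h := lineDvd_of_rationalMC_of_muZero prime_two_iwasawaAlgebra₂ hrat ρ hμ π hctrl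
  simpa [map_mul] using map_dvd (PowerSeries.constantCoeff) h

end Plan1

/-! ## §H  PLAN 2 assembly (primary road T1⁻, one-variable habitat `F_∞ = F₀·K^{𝔭}_∞`):
the (INT)/lattice/normalisation comparison holds up to powers of 2; `μ = 0` of Müller's `char Y`
(algebraic) and of OV16's branch product (analytic, SAME habitat) make the R2c-iv′ normalisation
digit PROVABLY ZERO — only the orientation clause (`IsConjugateSelfDual`) remains a datum. -/

section Plan2

variable {R : Type*} [CommRing R] [IsDomain R]

/-- **PLAN 2.** `f₋` = Müller's minus characteristic series, `L` = OV16-normalised branch product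
(times the μ-free imprimitivity factor `N_F`), identity up to `2^c` and a unit from T1⁻'s R2c:
then `(f₋) = (L)` on the nose and the digit `c` never enters `e_A`/`e_M`. -/
theorem plan2_span_eq_and_digit_zero {p fm L : R} (hp : Prime p) (hf : ¬ p ∣ fm) (hL : ¬ p ∣ L)
    {c : ℕ} {u : Rˣ} (h : fm = u * (p ^ c * L)) :
    Ideal.span {fm} = Ideal.span {L} ∧ c = 0 :=
  ⟨span_eq_of_eqUpToPow hp hf hL ⟨0, c, u, by simpa using h⟩, pow_index_eq_zero hf h⟩

end Plan2

/-! ## §I  PLAN 3 (P-shape normalisation clause): two normalisations `G' = c · G` of the same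
measure, both μ-free, differ by a UNIT constant — so a normalisation contributes `0` to every value
digit.  Over DVR coefficients every nonzero constant is `u · p^j`. -/

section Plan3

variable {R : Type*} [CommRing R] [IsDomain R]

omit [IsDomain R] in
theorem isUnit_const_of_muZero {p c G : R} {j : ℕ} {u : Rˣ} (hc : c = u * p ^ j)
    (hG' : ¬ p ∣ c * G) : IsUnit c := by
  rcases j with _ | j
  · rw [hc, pow_zero, mul_one]; exact Units.isUnit u
  · exact absurd ⟨↑u * p ^ j * G, by rw [hc]; ring⟩ hG'

end Plan3

/-! ## §J  Sanity instances (decidable shadows over `ℤ`, `p = 2`). -/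

section Sanity

/-- H1 in action: `3 ∣ 2² · 6` and `2 ∤ 3` ⟹ `3 ∣ 6`. -/
example : (3 : ℤ) ∣ 6 :=
  dvd_of_dvd_prime_pow_mul (p := 2) (k := 2) Int.prime_two (by decide) (by norm_num)

/-- The μ = 0 hypothesis is necessary (B13-type honesty): `2 ∣ 2¹ · 3` but `2 ∤ 3`. -/
example : (2 : ℤ) ∣ 2 ^ 1 * 3 ∧ ¬ (2 : ℤ) ∣ 3 := by decide

/-- PLAN 2's digit: `6 = 1 · (2^c · 3)` with `2 ∤ 6`?  No — `2 ∣ 6`; with `fm = 9 = 1·(2^0·9)` the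
digit is forced to `0`. -/
example {c : ℕ} (h : (9 : ℤ) = ((1 : ℤˣ) : ℤ) * (2 ^ c * 9)) : c = 0 :=
  pow_index_eq_zero (p := 2) (by decide) h

end Sanity

end Summit.BirchSwinnertonDyer.BirchSwinnertonDyer.Cruxes.SplitBadTwoLowerHalfOfFacts.StubIdeasK1G12
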